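import Mathlib
import Literature.Analysis.FunctionSpaces.TorusScalarTrigPoly
import Summits.AnomalousDissipation.AnomalousDissipation.Theorems.TwoAndHalfDTwohalfdThesisStubWeakDuhamel

/-!
# T3a `stub_releaseNormSqMeasurable`: joint measurability of the release norms

Stub T3a of the line `budgeted-mixer-template` (reshape r2) for the crux
`Summit.AnomalousDissipation.AnomalousDissipation.Theses.TwoAndHalfD.ScalarAnomalySteadySourceFormal`
(stmt-AnomalousDissipation-0448); the statement is registered verbatim in the line's checked
skeleton and is consumed there (through T3 `stub_meanSquareDuhamelVariance`) to make the
release-time integrals `∫ ‖φ s (t)‖² ds` honest.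

CONTENT.  Let `κ > 0`, `h` smooth, and for every release time `s ≥ 0` let `φ s` be a classical
solution of the UNFORCED advection–diffusion equation `∂ₜφ + u·∇φ = κΔφ` on `[s, ∞) × T²` with
`φ s s = h` (one drift `u`, jointly smooth and divergence free on `[0, ∞)` by the structure at
`s = 0`).  Then `(s, t) ↦ ‖φ s (t)‖²_{L²}` agrees on `{0 ≤ s ≤ t}` with a Borel measurable
function `G : ℝ × ℝ → ℝ`.

PROOF.
* `exists_continuousOn_testPairing` — DUALITY: for `t > 0` and a smooth real test function `χ`
  the pairing `s ↦ ∫ φ s (t) χ` is continuous on `[0, t]`; it equals `∫ h χ̃(t - s)` with `χ̃` the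
  reversed solution from the datum `χ` (`Torus.exists_isClassicalScalarTransportForcedOn`,
  `TwohalfdThesis.integral_mul_eq_of_reverse_shifted`), exactly as in
  `TwohalfdThesis.exists_continuousOn_releasePairing` (the case `χ = h`).
* The CLAMPED pairing `Q(s, t) := ∫ φ (s⁺) (max t s⁺) χ`, `s⁺ = max s 0`, is continuous in `t` for
  every `s` (space integrals of jointly smooth fields, `IsSmoothSpaceTimeOn.continuousOn_integral`;
  `continuous_clampedPairing_right`) and continuous in `s` for every `t` (constant for `t ≤ 0`; for
  `t > 0` it is `D (max 0 (min s t))` with the continuous `D` of the duality step, the pieces matching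
  because `φ σ σ = h`; `continuous_clampedPairing_left`), hence jointly Borel measurable
  (Carathéodory, Mathlib `measurable_uncurry_of_continuous_of_measurable`;
  `measurable_uncurry_clampedPairing`); on `0 ≤ s ≤ t` it is `∫ φ s (t) χ`
  (`exists_measurable_testPairing`).
* PARSEVAL (`Torus.hasSum_sq_norm_mFourierCoeff_ofReal`): `‖φ s t‖² = ∑ₖ ‖𝓕(φ s t)(k)‖²` and
  `‖𝓕g(k)‖² = (∫ g · Re e₋ₖ)² + (∫ g · Im e₋ₖ)²` with the smooth real modes
  `Re e₋ₖ = reTrigPoly {-k} 1`, `Im e₋ₖ = reTrigPoly {-k} (-i)` (`Torus.sq_norm_mFourierCoeff_ofReal`,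
  `Torus.isSmooth_reTrigPoly`), so `G := (s,t) ↦ ∑' k, (Q_{Re e₋ₖ}(s,t)² + Q_{Im e₋ₖ}(s,t)²)` works
  (`Measurable.tsum`).
Supports stmt-AnomalousDissipation-0448. [folklore: Evans 2010, §7.1.1 (adjoint problem);
Grafakos 2014, Prop. 3.2.7 (3) (Parseval); Aliprantis–Border 2006, Lemma 4.51 (Carathéodory
functions are jointly measurable)]
-/

noncomputable section

-- the summit path `AnomalousDissipation/AnomalousDissipation` duplicates a namespace component
set_option linter.dupNamespace false

namespace Summit.AnomalousDissipation.AnomalousDissipation.Theorems.ScalarAnomalySteadySourceFormal.ReleaseNormSqMeasurable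

open MeasureTheory Set Filter Topology
open scoped ENNReal NNReal
open Literature.Analysis.FunctionSpaces Literature.Analysis.FluidPDE

variable {d : Type*} [Fintype d] [DecidableEq d]

/-! ## Duality: the test pairings are continuous in the release time -/

/-- **Test pairings are continuous in the release time.** For `κ > 0`, `t > 0`, smooth `h`, `χ`
and classical unforced releases `φ s` of `h` at every `s ≥ 0` over one drift, there is a
continuous `D` on `[0, t]` with `∫ φ s (t) χ = D s` (`s ∈ [0, t]`): `D s = ∫ h χ̃(t - s)` with `χ̃`
the reversed solution from `χ` on `[0, t]` (`Torus.exists_isClassicalScalarTransportForcedOn`,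
`TwohalfdThesis.integral_mul_eq_of_reverse_shifted`; the case `χ = h` is
`TwohalfdThesis.exists_continuousOn_releasePairing`). [folklore] -/
theorem exists_continuousOn_testPairing {κ t : ℝ}
    {u : ℝ → UnitAddTorus d → EuclideanSpace ℝ d} {h χ : UnitAddTorus d → ℝ}
    {φ : ℝ → ℝ → UnitAddTorus d → ℝ} (hκ : 0 < κ) (ht : 0 < t) (hh : Torus.IsSmooth h)
    (hχ : Torus.IsSmooth χ)
    (hφ : ∀ s, 0 ≤ s → Torus.IsClassicalScalarTransportOn (Ici s) κ u (φ s) ∧ φ s s = h) :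
    ∃ D : ℝ → ℝ, ContinuousOn D (Icc 0 t) ∧ ∀ s ∈ Icc 0 t, ∫ x, φ s t x * χ x = D s := by
  have hu : Torus.IsSmoothSpaceTimeOn (Icc 0 t) u :=
    (hφ 0 le_rfl).1.smooth_velocity.mono Icc_subset_Ici_self
  have hdiv : ∀ σ ∈ Icc 0 t, Torus.IsDivFree (u σ) := fun σ hσ =>
    (hφ 0 le_rfl).1.divFree σ (Icc_subset_Ici_self hσ)
  have h0 : Torus.IsSmoothSpaceTimeOn (Icc 0 t) (fun (_ : ℝ) (_ : UnitAddTorus d) => (0 : ℝ)) :=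
    Torus.isSmoothSpaceTimeOn_const (Torus.isSmooth_const _) _
  obtain ⟨χt, hχt', hχt0⟩ := Torus.exists_isClassicalScalarTransportForcedOn hκ ht
    (Torus.isSmoothSpaceTimeOn_reverse_neg hu) (Torus.isDivFree_reverse hdiv) h0 hχ
  have hχt : Torus.IsClassicalScalarTransportOn (Icc 0 t) κ (fun σ x => -u (t - σ) x) χt :=
    TwohalfdThesis.isClassicalScalarTransportOn_of_forced_zero hχt'
  have hχrs : Torus.IsSmoothSpaceTimeOn (Icc 0 t) (fun σ x => χt (t - σ) x) :=
    Torus.IsSmoothSpaceTimeOn.reverse hχt.smooth_scalar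
  refine ⟨fun s => ∫ x, h x * χt (t - s) x, ?_, ?_⟩
  · exact ((Torus.isSmoothSpaceTimeOn_const hh _).mul hχrs).continuousOn_integral (convex_Icc 0 t)
  · intro s hs
    rcases eq_or_lt_of_le hs.2 with hst | hst
    · simp only [hst, sub_self, hχt0, (hφ t ht.le).2]
    · have hφs : Torus.IsClassicalScalarTransportOn (Icc s t) κ u (φ s) :=
        ((hφ s hs.1).1).restrict_Icc hst Icc_subset_Ici_self
      have hχs : Torus.IsClassicalScalarTransportOn (Icc 0 (t - s)) κ
          (fun σ x => -u (t - σ) x) χt :=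
        hχt.restrict_Icc (sub_pos.2 hst) (Icc_subset_Icc le_rfl (sub_le_self t hs.1))
      have e := TwohalfdThesis.integral_mul_eq_of_reverse_shifted hst hφs hχs
      rw [hχt0, (hφ s hs.1).2] at e
      exact e

/-! ## The clamped pairing: separately continuous, hence jointly measurable

The clamped test pairing is `Q(s, t) := ∫ φ (s⁺) (max t s⁺) χ`, `s⁺ = max s 0`: the pairing
`∫ φ s (t) χ` of the release from time `s` evaluated at time `t`, with the indices clamped into the
solution region `0 ≤ s ≤ t` (so that it is built from honest slices everywhere); it is written out
in full in the statements below. -/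

/-- **Continuity in the evaluation time.** For every `s`, `t ↦ Q(s, t) = ∫ φ (s⁺) (max t s⁺) χ` is
continuous on `ℝ` (the slice path `t ↦ φ σ t`, `σ = s⁺ ≥ 0`, is jointly smooth on `[σ, ∞)`, so
`t ↦ ∫ φ σ (t) χ` is continuous there, `IsSmoothSpaceTimeOn.continuousOn_integral`; compose with
`t ↦ max t σ`). [folklore] -/
theorem continuous_clampedPairing_right {κ : ℝ} {u : ℝ → UnitAddTorus d → EuclideanSpace ℝ d}
    {h χ : UnitAddTorus d → ℝ} {φ : ℝ → ℝ → UnitAddTorus d → ℝ} (hχ : Torus.IsSmooth χ)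
    (hφ : ∀ s, 0 ≤ s → Torus.IsClassicalScalarTransportOn (Ici s) κ u (φ s) ∧ φ s s = h) (s : ℝ) :
    Continuous fun t => ∫ x, φ (max s 0) (max t (max s 0)) x * χ x := by
  have hσ : 0 ≤ max s 0 := le_max_right s 0
  have hc : ContinuousOn (fun t => ∫ x, φ (max s 0) t x * χ x) (Ici (max s 0)) :=
    ((hφ _ hσ).1.smooth_scalar.mul (Torus.isSmoothSpaceTimeOn_const hχ _)).continuousOn_integral
      (convex_Ici _)
  exact hc.comp_continuous (continuous_id.max continuous_const) fun t => Set.mem_Ici.2 (le_max_right _ _)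

/-- **Continuity in the release time.** For `κ > 0`, smooth `h`, `χ` and every `t`,
`s ↦ Q(s, t) = ∫ φ (s⁺) (max t s⁺) χ` is continuous on `ℝ`: for `t ≤ 0` it is the constant `∫ h χ`
(`φ σ σ = h`); for `t > 0` it is `D (max 0 (min s t))` with the continuous `D` of
`exists_continuousOn_testPairing` (for `s ≤ 0` both are `∫ φ 0 (t) χ`, for `0 ≤ s ≤ t` both are
`∫ φ s (t) χ`, for `s ≥ t` both are `∫ h χ`). [folklore] -/
theorem continuous_clampedPairing_left {κ : ℝ} {u : ℝ → UnitAddTorus d → EuclideanSpace ℝ d}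
    {h χ : UnitAddTorus d → ℝ} {φ : ℝ → ℝ → UnitAddTorus d → ℝ} (hκ : 0 < κ)
    (hh : Torus.IsSmooth h) (hχ : Torus.IsSmooth χ)
    (hφ : ∀ s, 0 ≤ s → Torus.IsClassicalScalarTransportOn (Ici s) κ u (φ s) ∧ φ s s = h) (t : ℝ) :
    Continuous fun s => ∫ x, φ (max s 0) (max t (max s 0)) x * χ x := by
  rcases le_or_gt t 0 with ht | ht
  · refine (continuous_const : Continuous fun _ : ℝ => ∫ x, h x * χ x).congr fun s => ?_
    show ∫ x, h x * χ x = ∫ x, φ (max s 0) (max t (max s 0)) x * χ x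
    rw [max_eq_right (ht.trans (le_max_right s 0)), (hφ _ (le_max_right s 0)).2]
  · obtain ⟨D, hD, hDeq⟩ := exists_continuousOn_testPairing hκ ht hh hχ hφ
    have hc : Continuous fun s => D (max 0 (min s t)) :=
      hD.comp_continuous (continuous_const.max (continuous_id.min continuous_const)) fun s =>
        ⟨le_max_left _ _, max_le ht.le (min_le_right s t)⟩
    refine hc.congr fun s => ?_
    show D (max 0 (min s t)) = ∫ x, φ (max s 0) (max t (max s 0)) x * χ x
    rcases le_total s 0 with hs | hs
    · rw [max_eq_right hs, max_eq_left ht.le, min_eq_left (hs.trans ht.le), max_eq_left hs]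
      exact (hDeq 0 ⟨le_rfl, ht.le⟩).symm
    · rcases le_total s t with hst | hts
      · rw [max_eq_left hs, max_eq_left hst, min_eq_left hst, max_eq_right hs]
        exact (hDeq s ⟨hs, hst⟩).symm
      · rw [max_eq_left hs, max_eq_right hts, min_eq_right hts, max_eq_right ht.le, (hφ s hs).2,
          ← hDeq t ⟨ht.le, le_rfl⟩, (hφ t ht.le).2]

/-- **Joint measurability of the clamped pairing** (Carathéodory: continuous in the release time
for every evaluation time, measurable — indeed continuous — in the evaluation time for every release
time; Mathlib `measurable_uncurry_of_continuous_of_measurable`). [folklore] -/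
theorem measurable_uncurry_clampedPairing {κ : ℝ} {u : ℝ → UnitAddTorus d → EuclideanSpace ℝ d}
    {h χ : UnitAddTorus d → ℝ} {φ : ℝ → ℝ → UnitAddTorus d → ℝ} (hκ : 0 < κ)
    (hh : Torus.IsSmooth h) (hχ : Torus.IsSmooth χ)
    (hφ : ∀ s, 0 ≤ s → Torus.IsClassicalScalarTransportOn (Ici s) κ u (φ s) ∧ φ s s = h) :
    Measurable (Function.uncurry fun s t => ∫ x, φ (max s 0) (max t (max s 0)) x * χ x) :=
  measurable_uncurry_of_continuous_of_measurable
    (fun t => continuous_clampedPairing_left hκ hh hχ hφ t)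
    (fun s => (continuous_clampedPairing_right hχ hφ s).measurable)

/-- **Measurable extension of the test pairings.** For `κ > 0`, smooth `h`, `χ` and classical
unforced releases `φ s` of `h` (`s ≥ 0`) over one drift, `(s, t) ↦ ∫ φ s (t) χ` agrees on
`{0 ≤ s ≤ t}` with a Borel measurable function on `ℝ × ℝ` (the clamped pairing). [folklore] -/
theorem exists_measurable_testPairing {κ : ℝ} {u : ℝ → UnitAddTorus d → EuclideanSpace ℝ d}
    {h χ : UnitAddTorus d → ℝ} {φ : ℝ → ℝ → UnitAddTorus d → ℝ} (hκ : 0 < κ)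
    (hh : Torus.IsSmooth h) (hχ : Torus.IsSmooth χ)
    (hφ : ∀ s, 0 ≤ s → Torus.IsClassicalScalarTransportOn (Ici s) κ u (φ s) ∧ φ s s = h) :
    ∃ Q : ℝ × ℝ → ℝ, Measurable Q ∧ ∀ s t, 0 ≤ s → s ≤ t → Q (s, t) = ∫ x, φ s t x * χ x :=
  ⟨Function.uncurry fun s t => ∫ x, φ (max s 0) (max t (max s 0)) x * χ x,
    measurable_uncurry_clampedPairing hκ hh hχ hφ, fun s t hs hst => by
      simp only [Function.uncurry_apply_pair, max_eq_left hs, max_eq_left hst]⟩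

/-! ## The registered stub -/

/-- **T3a `stub_releaseNormSqMeasurable`.**  For `κ > 0`, a smooth datum `h` and classical unforced
releases `φ s` of `h` at every `s ≥ 0` over one drift (jointly smooth and divergence free on `[0, ∞)`
by the structure at `s = 0`), the map `(s, t) ↦ ‖φ s (t)‖²_{L²}` agrees on `{0 ≤ s ≤ t}` with a
Borel measurable function on `ℝ × ℝ`: `G (s,t) := ∑' k, (Q_{Re e₋ₖ}(s,t)² + Q_{Im e₋ₖ}(s,t)²)` with the
jointly measurable clamped pairings `Q` against the smooth real modes `Re e₋ₖ = reTrigPoly {-k} 1`,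
`Im e₋ₖ = reTrigPoly {-k} (-i)` (`exists_measurable_testPairing`, `Torus.isSmooth_reTrigPoly`,
`Measurable.tsum`), which on the region equals `∑ₖ ‖𝓕(φ s t)(k)‖² = ‖φ s t‖²` (Parseval,
`Torus.hasSum_sq_norm_mFourierCoeff_ofReal`, `Torus.sq_norm_mFourierCoeff_ofReal`). [folklore] -/
theorem stub_releaseNormSqMeasurable :
    ∀ (κ : ℝ) (u : ℝ → UnitAddTorus (Fin 2) → EuclideanSpace ℝ (Fin 2)) (h : UnitAddTorus (Fin 2) → ℝ)
      (φ : ℝ → ℝ → UnitAddTorus (Fin 2) → ℝ),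
      0 < κ → Torus.IsSmooth h →
      (∀ s, 0 ≤ s → Torus.IsClassicalScalarTransportOn (Set.Ici s) κ u (φ s) ∧ φ s s = h) →
      ∃ G : ℝ × ℝ → ℝ, Measurable G ∧ ∀ s t, 0 ≤ s → s ≤ t → G (s, t) = Torus.scalarL2Sq (φ s t) := by
  intro κ u h φ hκ hh hφ
  choose Q hQm hQeq using fun (w : ℂ) (k : Fin 2 → ℤ) =>
    exists_measurable_testPairing hκ hh (Torus.isSmooth_reTrigPoly {-k} fun _ => w) hφ
  refine ⟨fun p => ∑' k : Fin 2 → ℤ, (Q 1 k p ^ 2 + Q (-Complex.I) k p ^ 2), ?_, ?_⟩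
  · exact Measurable.tsum fun k => ((hQm _ k).pow_const 2).add ((hQm _ k).pow_const 2)
  · intro s t hs hst
    have hsm : Torus.IsSmooth (φ s t) :=
      (hφ s hs).1.smooth_scalar.isSmooth_slice (show t ∈ Set.Ici s from hst)
    have hP := Torus.hasSum_sq_norm_mFourierCoeff_ofReal (hsm.memLp 2)
    have hk : ∀ k : Fin 2 → ℤ, Q 1 k (s, t) ^ 2 + Q (-Complex.I) k (s, t) ^ 2 =
        ‖UnitAddTorus.mFourierCoeff (fun x => (φ s t x : ℂ)) k‖ ^ 2 := fun k => by
      rw [hQeq _ k s t hs hst, hQeq _ k s t hs hst, Torus.sq_norm_mFourierCoeff_ofReal hsm.integrable]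
    simp only [hk]
    exact hP.tsum_eq

end Summit.AnomalousDissipation.AnomalousDissipation.Theorems.ScalarAnomalySteadySourceFormal.ReleaseNormSqMeasurable

end
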